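import Mathlib
import HarnessLib
import Literature.Probability.LatticeModels.TorusBlockFourier
import Literature.Probability.LatticeModels.TorusCentredLift
import Summits.HubbardSuperconductivity.HubbardSuperconductivity.Theorems.KLProgrammeKLRegimeVolumeLimitCutoffDoorsV14

/-!
# VL child `KLRegimeVolumeLimitV14` (stmt-HubbardSuperconductivity-19921), «cauchy» v2 stub `stub_vl_rates`:
# POISSON SUMMATION ON NESTED TORI — the position-space form of the nested two-volume rate and of the momentum modulus
# (cell gate-hubbard-kl, seat hubbard-kl-k3c5-p3 g5, technique «OS-positivity-free direct assembly»; `--supports` 19921)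

Companion of `…VolumeLimitNestedRates` («nested volumes suffice»: the registered `stub_vl_rates` follows from (b2n) a NESTED
same-momentum rate `L ∣ L″, p_{k″} = p_k ⇒ ‖T_L k − T_{L″} k″‖ ≤ ρ L` and (b2m) a ONE-volume momentum modulus
`‖T_L k₁ − T_L k₂‖ ≤ ρ′ L + D·Σ_i |p_{k₁} i − p_{k₂} i|_𝕋`).  Here both inputs are put in POSITION space, for momentum functions given as
discrete Fourier transforms `T = torusFourier s` of a site kernel `s` on the torus (`Σ_z s(z) conj χ_k(z)`):

* **Poisson on nested tori** (`torusFourier_lift_eq_torusFourier_periodise`, any dimension `d`, `M = b·m`): the fine transform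
  `torusFourier g` of a kernel `g` on `(ℤ/Mℤ)^d`, read at the LIFT `b·k` of a coarse momentum `k ∈ (ℤ/mℤ)^d` (the same physical momentum,
  `latticeMomentum_lift`; the lift is the ONLY fine index with that momentum, `eq_lift_of_latticeMomentum_eq`), equals the coarse transform of
  the PERIODISED kernel `y ↦ Σ_{x ≡ y (mod m)} g(x)` — because the fine character at `b·k` is the coarse character of the reduced site
  (`TorusBlock.torusChar_lift_eq_reduce`).  Hence (`norm_torusFourier_sub_torusFourier_of_latticeMomentum_eq`)
  `p_{k″} = p_k ⇒ ‖torusFourier h k − torusFourier g k″‖ ≤ Σ_y ‖h(y) − Σ_{x ≡ y} g(x)‖`: the nested rate (b2n) IS the `ℓ¹`-comparability of the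
  torus-`m` kernel with the periodised torus-`M` kernel — a statement about two finite volumes.
* **Momentum modulus from the first site moment** (`norm_torusFourier_sub_torusFourier_le_firstMoment`): with centred representatives
  `z̃ = Torus.cRepZ`, `‖torusFourier s k₁ − torusFourier s k₂‖ ≤ (Σ_z ‖z̃‖₁ ‖s z‖) · Σ_i |p_{k₁} i − p_{k₂} i|_𝕋` (characters as `exp(i p·z̃)`,
  `torusChar_eq_exp_cRepZ`; `|e^{iθ} − 1| ≤ |θ|` after reducing each `p_{k₁} i − p_{k₂} i` modulo `2π`, which integer `z̃` cannot see).
* **The six-point scalar is such a transform** (`klSixInf_eq_torusFourier`): `klSixInf L β U μ n = torusFourier (sixSite)` with the inline site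
  kernel `z ↦ (∫₀^β e^{−iω_n u} S∞(z,u) du)/D∞` — so the engine's (b2n)/(b2m) for `klSixInf` are statements about this kernel.

Everything is proved; no definition (periodisation, lift and site kernel are written inline); nothing is asserted about the model.
References: S. Friedli, Y. Velenik, *Statistical Mechanics of Lattice Systems* (CUP 2017) §10.4; J. Glimm, A. Jaffe, *Quantum Physics* §7.3.
-/

noncomputable section

namespace Summit.HubbardSuperconductivity.HubbardSuperconductivity.Theorems.TwoPointAssembly

set_option linter.dupNamespace false -- summit = problem name (single-conjunct summit), D-0017

open Finset Filter Topology Complex Literature.MathematicalPhysics.QuantumLattice Literature.Probability.LatticeModels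
open Literature.MathematicalPhysics.QuantumLattice.FermiRG
open Summit.HubbardSuperconductivity.HubbardSuperconductivity.Theorems.KLRegimeSplit
open Summit.HubbardSuperconductivity.HubbardSuperconductivity.Theorems.KLProgrammeLegKernels
open scoped ComplexConjugate

/-! ## §1 The lift of a coarse momentum to a nested fine grid -/

section Nested

variable {d b m M : ℕ} [NeZero M] [NeZero m]

/-- **The lift carries the same physical momentum**: `p_{b·k} = p_k` for `M = b·m`. [folklore] -/
theorem latticeMomentum_lift (hM : M = b * m) (k : TorusSite d m) :
    latticeMomentum M (fun j => ((b * (k j).val : ℕ) : ZMod M)) = latticeMomentum m k := by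
  have hb : 0 < b := Nat.pos_of_ne_zero (by rintro rfl; exact NeZero.ne M (by simpa using hM))
  funext j
  simp only [latticeMomentum]
  have hlt : b * (k j).val < M := by rw [hM]; exact (Nat.mul_lt_mul_left hb).2 (ZMod.val_lt (k j))
  rw [ZMod.val_natCast, Nat.mod_eq_of_lt hlt, hM]
  have hmR : (m : ℝ) ≠ 0 := by exact_mod_cast NeZero.ne m
  have hbR : (b : ℝ) ≠ 0 := by exact_mod_cast hb.ne'
  push_cast
  field_simp

/-- **The lift is the only fine index with that momentum**: `p_{k″} = p_k ⇒ k″ = b·k` (`M = b·m`). [folklore] -/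
theorem eq_lift_of_latticeMomentum_eq (hM : M = b * m) {k : TorusSite d m} {k'' : TorusSite d M}
    (h : latticeMomentum M k'' = latticeMomentum m k) : k'' = fun j => ((b * (k j).val : ℕ) : ZMod M) := by
  funext j
  have hj := congr_fun h j
  simp only [latticeMomentum] at hj
  have hMR : (M : ℝ) ≠ 0 := by exact_mod_cast NeZero.ne M
  have hmR : (m : ℝ) ≠ 0 := by exact_mod_cast NeZero.ne m
  have hπ : (2 * Real.pi : ℝ) ≠ 0 := by positivity
  -- cross-multiply: `v″·m = v·M = v·b·m`
  have hcross : ((k'' j).val : ℝ) * m = (k j).val * M := by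
    field_simp at hj
    linarith [hj]
  have hnat : (k'' j).val * m = ((k j).val * b) * m := by
    have : ((k'' j).val : ℝ) * m = ((k j).val * b) * m := by rw [hcross, hM]; push_cast; ring
    exact_mod_cast this
  have hval : (k'' j).val = b * (k j).val := by
    have := Nat.eq_of_mul_eq_mul_right (Nat.pos_of_ne_zero (NeZero.ne m)) hnat
    rw [this, mul_comm]
  rw [← ZMod.natCast_zmod_val (k'' j), hval]

/-! ## §2 Poisson summation on nested tori: restriction to the coarse grid = periodisation of the kernel -/

/-- The fine character at a lifted coarse momentum is the coarse character of the reduced site: `χ_{b·k}(x) = χ_k(x mod m)`. [folklore] -/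
theorem torusChar_lift_apply (hM : M = b * m) (k : TorusSite d m) (x : TorusSite d M) :
    torusChar (fun j => ((b * (k j).val : ℕ) : ZMod M)) x = torusChar k (fun i => (((x i).val : ℕ) : ZMod m)) := by
  rw [torusChar_comm, TorusBlock.torusChar_lift_eq_reduce hM x k, torusChar_comm]

/-- **Poisson summation on nested tori.**  For `M = b·m` and a kernel `g` on the fine torus `(ℤ/Mℤ)^d`, the fine Fourier transform at the
lift `b·k` of a coarse momentum equals the coarse Fourier transform, at `k`, of the PERIODISED kernel `y ↦ Σ_{x ≡ y (mod m)} g(x)`. [folklore] -/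
theorem torusFourier_lift_eq_torusFourier_periodise (hM : M = b * m) (g : TorusSite d M → ℂ) (k : TorusSite d m) :
    torusFourier g (fun j => ((b * (k j).val : ℕ) : ZMod M)) =
      torusFourier (fun y : TorusSite d m =>
        ∑ x ∈ Finset.univ.filter (fun x : TorusSite d M => (fun i => (((x i).val : ℕ) : ZMod m)) = y), g x) k := by
  classical
  rw [torusFourier_eq_sum_torusChar, torusFourier_eq_sum_torusChar]
  have hR : ∀ y : TorusSite d m,
      (∑ x ∈ Finset.univ.filter (fun x : TorusSite d M => (fun i => (((x i).val : ℕ) : ZMod m)) = y), g x) * conj (torusChar k y) =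
        ∑ x ∈ Finset.univ.filter (fun x : TorusSite d M => (fun i => (((x i).val : ℕ) : ZMod m)) = y),
          g x * conj (torusChar k (fun i => (((x i).val : ℕ) : ZMod m))) := by
    intro y
    rw [Finset.sum_mul]
    refine Finset.sum_congr rfl fun x hx => ?_
    rw [(Finset.mem_filter.1 hx).2]
  rw [Finset.sum_congr rfl fun y _ => hR y,
    Finset.sum_fiberwise Finset.univ (fun x : TorusSite d M => (fun i => (((x i).val : ℕ) : ZMod m)))
      (fun x => g x * conj (torusChar k (fun i => (((x i).val : ℕ) : ZMod m))))]
  refine Finset.sum_congr rfl fun x _ => ?_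
  rw [torusChar_lift_apply hM]

/-- **Sup over the coarse grid ≤ `ℓ¹` of the kernel difference**: for kernels `h` (coarse) and `g` (fine, `M = b·m`),
`‖torusFourier h k − torusFourier g (b·k)‖ ≤ Σ_y ‖h(y) − Σ_{x ≡ y} g(x)‖`. [folklore] -/
theorem norm_torusFourier_sub_torusFourier_lift_le (hM : M = b * m) (h : TorusSite d m → ℂ) (g : TorusSite d M → ℂ)
    (k : TorusSite d m) :
    ‖torusFourier h k - torusFourier g (fun j => ((b * (k j).val : ℕ) : ZMod M))‖ ≤
      ∑ y : TorusSite d m, ‖h y - ∑ x ∈ Finset.univ.filter (fun x : TorusSite d M => (fun i => (((x i).val : ℕ) : ZMod m)) = y), g x‖ := by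
  classical
  rw [torusFourier_lift_eq_torusFourier_periodise hM, torusFourier_eq_sum_torusChar, torusFourier_eq_sum_torusChar,
    ← Finset.sum_sub_distrib]
  refine (norm_sum_le _ _).trans (le_of_eq (Finset.sum_congr rfl fun y _ => ?_))
  rw [← sub_mul, norm_mul, Complex.norm_conj, norm_torusChar, mul_one]

/-- **Equal-momentum form** (the hypothesis shape of `twoVolumeRate_of_nestedRate`): if `p_{k″} = p_k` then
`‖torusFourier h k − torusFourier g k″‖ ≤ Σ_y ‖h(y) − Σ_{x ≡ y} g(x)‖`. [folklore] -/
theorem norm_torusFourier_sub_torusFourier_of_latticeMomentum_eq (hM : M = b * m) (h : TorusSite d m → ℂ) (g : TorusSite d M → ℂ)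
    {k : TorusSite d m} {k'' : TorusSite d M} (hk : latticeMomentum M k'' = latticeMomentum m k) :
    ‖torusFourier h k - torusFourier g k''‖ ≤
      ∑ y : TorusSite d m, ‖h y - ∑ x ∈ Finset.univ.filter (fun x : TorusSite d M => (fun i => (((x i).val : ℕ) : ZMod m)) = y), g x‖ := by
  rw [eq_lift_of_latticeMomentum_eq hM hk]
  exact norm_torusFourier_sub_torusFourier_lift_le hM h g k

end Nested

/-! ## §3 Characters as exponentials of `p·z̃` and the momentum modulus from the first site moment -/

section Moment

variable {d L : ℕ} [NeZero L]

/-- One coordinate: `e(a z) = exp(i p_a z̃)`, `p_a = 2πa/L`, `z̃ = Torus.cRepZ z` the centred representative. [folklore] -/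
theorem stdAddChar_mul_eq_exp_cRepZ (a z : ZMod L) :
    (ZMod.stdAddChar (a * z) : ℂ) = Complex.exp (Complex.I * (((2 * Real.pi * (a.val : ℝ) / L) * (Torus.cRepZ z : ℝ) : ℝ) : ℂ)) := by
  have h : a * z = ((((a.val : ℤ) * Torus.cRepZ z : ℤ)) : ZMod L) := by
    push_cast
    rw [ZMod.natCast_zmod_val, Torus.intCast_cRepZ]
  rw [h, ZMod.stdAddChar_coe]
  congr 1
  have hL : (L : ℂ) ≠ 0 := by exact_mod_cast NeZero.ne L
  push_cast
  field_simp

/-- **`χ_k(z) = exp(i p_k·z̃)`** with `z̃` the centred representative of `z`. [folklore] -/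
theorem torusChar_eq_exp_cRepZ (k z : TorusSite d L) :
    torusChar k z = Complex.exp (Complex.I * ((∑ i, latticeMomentum L k i * (Torus.cRepZ (z i) : ℝ) : ℝ) : ℂ)) := by
  unfold torusChar
  simp_rw [stdAddChar_mul_eq_exp_cRepZ]
  rw [← Complex.exp_sum]
  congr 1
  simp only [latticeMomentum]
  push_cast
  rw [Finset.mul_sum]

/-- **Characters are Lipschitz in the momentum, modulo `2π`, at rate `‖z̃‖₁`**:
`‖χ_{k₁}(z) − χ_{k₂}(z)‖ ≤ Σ_i |z̃_i| · |p_{k₁} i − p_{k₂} i|_𝕋`. [folklore] -/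
theorem norm_torusChar_sub_torusChar_le (k₁ k₂ z : TorusSite d L) :
    ‖torusChar k₁ z - torusChar k₂ z‖ ≤ ∑ i, |(Torus.cRepZ (z i) : ℝ)| * torusAbs (latticeMomentum L k₁ i - latticeMomentum L k₂ i) := by
  set zt : Fin d → ℝ := fun i => (Torus.cRepZ (z i) : ℝ) with hzt
  set A : ℝ := ∑ i, latticeMomentum L k₁ i * zt i with hA
  set B : ℝ := ∑ i, latticeMomentum L k₂ i * zt i with hB
  -- reduce the momentum difference modulo `2π` coordinatewise
  set θ : Fin d → ℝ := fun i => toIocMod Real.two_pi_pos (-Real.pi) (latticeMomentum L k₁ i - latticeMomentum L k₂ i) with hθ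
  set nI : Fin d → ℤ := fun i => toIocDiv Real.two_pi_pos (-Real.pi) (latticeMomentum L k₁ i - latticeMomentum L k₂ i) with hnI
  have hdecomp : ∀ i, latticeMomentum L k₁ i - latticeMomentum L k₂ i = θ i + (nI i : ℝ) * (2 * Real.pi) := by
    intro i
    have h := toIocMod_add_toIocDiv_zsmul Real.two_pi_pos (-Real.pi) (latticeMomentum L k₁ i - latticeMomentum L k₂ i)
    rw [zsmul_eq_mul] at h
    simp only [hθ, hnI]
    linarith
  set C : ℝ := ∑ i, θ i * zt i with hC
  set N : ℤ := ∑ i, nI i * Torus.cRepZ (z i) with hN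
  have hAB : A - B = C + (N : ℝ) * (2 * Real.pi) := by
    simp only [hA, hB, hC, hN, hzt]
    rw [← Finset.sum_sub_distrib]
    push_cast
    rw [Finset.sum_mul, ← Finset.sum_add_distrib]
    refine Finset.sum_congr rfl fun i _ => ?_
    rw [← sub_mul, hdecomp i]
    ring
  rw [torusChar_eq_exp_cRepZ, torusChar_eq_exp_cRepZ]
  change ‖Complex.exp (Complex.I * (A : ℂ)) - Complex.exp (Complex.I * (B : ℂ))‖ ≤ _
  have hexp : Complex.exp (Complex.I * (A : ℂ)) = Complex.exp (Complex.I * (B : ℂ)) * Complex.exp (Complex.I * (C : ℂ)) := by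
    have hA' : (A : ℂ) = (B : ℂ) + (C : ℂ) + (N : ℂ) * (2 * (Real.pi : ℂ)) := by
      have : A = B + C + (N : ℝ) * (2 * Real.pi) := by linarith [hAB]
      rw [this]; push_cast; ring
    rw [hA', show Complex.I * ((B : ℂ) + (C : ℂ) + (N : ℂ) * (2 * (Real.pi : ℂ))) =
        Complex.I * B + Complex.I * C + (N : ℂ) * (2 * Real.pi * Complex.I) by ring,
      Complex.exp_add, Complex.exp_add, Complex.exp_int_mul_two_pi_mul_I, mul_one]
  have hfac : Complex.exp (Complex.I * (A : ℂ)) - Complex.exp (Complex.I * (B : ℂ)) =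
      Complex.exp (Complex.I * (B : ℂ)) * (Complex.exp (Complex.I * (C : ℂ)) - 1) := by
    rw [hexp]; ring
  rw [hfac, norm_mul, mul_comm Complex.I (B : ℂ), Complex.norm_exp_ofReal_mul_I, one_mul]
  refine (Real.norm_exp_I_mul_ofReal_sub_one_le).trans ?_
  rw [Real.norm_eq_abs, hC]
  refine (Finset.abs_sum_le_sum_abs _ _).trans (le_of_eq (Finset.sum_congr rfl fun i _ => ?_))
  rw [abs_mul, mul_comm]
  rfl

/-- **Momentum modulus from the first site moment**: for a site kernel `s` on `(ℤ/Lℤ)^d`,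
`‖torusFourier s k₁ − torusFourier s k₂‖ ≤ (Σ_z ‖z̃‖₁ ‖s z‖) · Σ_i |p_{k₁} i − p_{k₂} i|_𝕋` (`‖z̃‖₁ = Σ_i |z̃_i|`). [folklore] -/
theorem norm_torusFourier_sub_torusFourier_le_firstMoment (s : TorusSite d L → ℂ) (k₁ k₂ : TorusSite d L) :
    ‖torusFourier s k₁ - torusFourier s k₂‖ ≤
      (∑ z, (∑ i, |(Torus.cRepZ (z i) : ℝ)|) * ‖s z‖) * ∑ i, torusAbs (latticeMomentum L k₁ i - latticeMomentum L k₂ i) := by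
  set T : ℝ := ∑ i, torusAbs (latticeMomentum L k₁ i - latticeMomentum L k₂ i) with hT
  have hT0 : 0 ≤ T := Finset.sum_nonneg fun i _ => abs_nonneg _
  rw [torusFourier_eq_sum_torusChar, torusFourier_eq_sum_torusChar, ← Finset.sum_sub_distrib, Finset.sum_mul]
  refine (norm_sum_le _ _).trans (Finset.sum_le_sum fun z _ => ?_)
  rw [← mul_sub, norm_mul, ← map_sub, Complex.norm_conj]
  have hχ := norm_torusChar_sub_torusChar_le k₁ k₂ z
  have hsum : ∑ i, |(Torus.cRepZ (z i) : ℝ)| * torusAbs (latticeMomentum L k₁ i - latticeMomentum L k₂ i) ≤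
      (∑ i, |(Torus.cRepZ (z i) : ℝ)|) * T := by
    rw [hT, Finset.sum_mul]
    refine Finset.sum_le_sum fun i _ => mul_le_mul_of_nonneg_left ?_ (abs_nonneg _)
    exact Finset.single_le_sum (f := fun j => torusAbs (latticeMomentum L k₁ j - latticeMomentum L k₂ j))
      (fun j _ => klvc_torusAbs_nonneg _) (Finset.mem_univ i)
  calc ‖s z‖ * ‖torusChar k₁ z - torusChar k₂ z‖ ≤ ‖s z‖ * ((∑ i, |(Torus.cRepZ (z i) : ℝ)|) * T) :=
        mul_le_mul_of_nonneg_left (hχ.trans hsum) (norm_nonneg _)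
    _ = (∑ i, |(Torus.cRepZ (z i) : ℝ)|) * ‖s z‖ * T := by ring

end Moment

/-! ## §4 The six-point scalar is the torus Fourier transform of a site kernel -/

section Six

variable {L : ℕ} [NeZero L]

/-- **`klSixInf L β U μ n = torusFourier (sixSite n)`** with the inline site kernel `z ↦ (∫₀^β e^{−iω_n u} S∞(z,u) du)/D∞`,
`ω_n = π(2n+1)/β` (`β > 0`): the six-point scalar of `stub_vl_rates` is the discrete Fourier transform of a position kernel. -/
theorem klSixInf_eq_torusFourier {β : ℝ} (hβ : 0 < β) (U μ : ℝ) (n : ℤ) (p : TorusSite 2 L) :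
    klSixInf L β U μ n p =
      torusFourier (fun z : TorusSite 2 L =>
        (∫ u in (0 : ℝ)..β, Complex.exp (-(((Real.pi * (2 * (n : ℝ) + 1) / β * u : ℝ) : ℂ) * Complex.I)) * klSixWordInf L β U μ z u) /
          klDInf L β U μ) p := by
  unfold klSixInf
  rw [torusFourier_eq_sum_torusChar]
  -- integrability of each summand
  have hcont : Continuous fun u : ℝ => Complex.exp (-(((Real.pi * (2 * (n : ℝ) + 1) / β * u : ℝ) : ℂ) * Complex.I)) := by fun_prop
  have hint : ∀ z : TorusSite 2 L, IntervalIntegrable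
      (fun u : ℝ => Complex.exp (-(((Real.pi * (2 * (n : ℝ) + 1) / β * u : ℝ) : ℂ) * Complex.I)) * conj (torusChar p z) *
        klSixWordInf L β U μ z u) MeasureTheory.volume 0 β := by
    intro z
    have h := (klSixWordInf_integrable_and_l1 (L := L) hβ U μ z).1
    exact h.continuousOn_mul ((hcont.mul continuous_const).continuousOn)
  rw [intervalIntegral.integral_finsetSum fun z _ => hint z, Finset.sum_div]
  refine Finset.sum_congr rfl fun z _ => ?_
  have hcm : (fun u : ℝ => Complex.exp (-(((Real.pi * (2 * (n : ℝ) + 1) / β * u : ℝ) : ℂ) * Complex.I)) * conj (torusChar p z) *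
      klSixWordInf L β U μ z u) = fun u => conj (torusChar p z) *
        (Complex.exp (-(((Real.pi * (2 * (n : ℝ) + 1) / β * u : ℝ) : ℂ) * Complex.I)) * klSixWordInf L β U μ z u) := by
    funext u; ring
  rw [hcm, intervalIntegral.integral_const_mul]
  ring

end Six

/-! ## §5 Poisson, inverse form: periodising an inverse transform = inverse transform of the restriction; sampled kernels periodise EXACTLY -/

section NestedInv

variable {d b m M : ℕ} [NeZero M] [NeZero m]

/-- **Poisson summation on nested tori, inverse form.**  For `M = b·m`, periodising the inverse Fourier transform of `g` from the fine torus to the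
coarse one gives the inverse Fourier transform of the RESTRICTION of `g` to the lifted coarse momenta:
`Σ_{x ≡ y (mod m)} 𝓕⁻¹_M g (x) = 𝓕⁻¹_m (k ↦ g(b·k)) (y)`. [folklore] -/
theorem periodise_torusFourierInv_eq (hM : M = b * m) (g : TorusSite d M → ℂ) (y : TorusSite d m) :
    ∑ x ∈ Finset.univ.filter (fun x : TorusSite d M => (fun i => (((x i).val : ℕ) : ZMod m)) = y), torusFourierInv g x =
      torusFourierInv (fun k : TorusSite d m => g (fun j => ((b * (k j).val : ℕ) : ZMod M))) y := by
  -- both sides have the same Fourier transform (forward Poisson + inversion), and the transform is injective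
  have key : torusFourier (fun y : TorusSite d m =>
        ∑ x ∈ Finset.univ.filter (fun x : TorusSite d M => (fun i => (((x i).val : ℕ) : ZMod m)) = y), torusFourierInv g x) =
      torusFourier (torusFourierInv (fun k : TorusSite d m => g (fun j => ((b * (k j).val : ℕ) : ZMod M)))) := by
    funext k
    rw [← torusFourier_lift_eq_torusFourier_periodise hM (torusFourierInv g) k,
      torusFourier_torusFourierInv_holds (d := d) (L := M) g,
      torusFourier_torusFourierInv_holds (d := d) (L := m) (fun k : TorusSite d m => g (fun j => ((b * (k j).val : ℕ) : ZMod M)))]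
  have h := congrArg torusFourierInv key
  rw [torusFourier_inversion_holds (d := d) (L := m), torusFourier_inversion_holds (d := d) (L := m)] at h
  exact congrFun h y

/-- **Grid-sampled kernels periodise EXACTLY** (the base case of a nested two-volume pass: `ρ = 0`): for any symbol `f` on continuum momenta, the
position kernel of its `grid_M` samples, periodised to the coarse torus, IS the position kernel of its `grid_m` samples (`M = b·m`). [folklore] -/
theorem periodise_torusFourierInv_sample_eq (hM : M = b * m) (f : (Fin d → ℝ) → ℂ) (y : TorusSite d m) :
    ∑ x ∈ Finset.univ.filter (fun x : TorusSite d M => (fun i => (((x i).val : ℕ) : ZMod m)) = y),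
        torusFourierInv (fun k : TorusSite d M => f (latticeMomentum M k)) x =
      torusFourierInv (fun k : TorusSite d m => f (latticeMomentum m k)) y := by
  rw [periodise_torusFourierInv_eq hM]
  congr 1
  funext k
  rw [latticeMomentum_lift hM]

end NestedInv

end Summit.HubbardSuperconductivity.HubbardSuperconductivity.Theorems.TwoPointAssembly

end
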